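import Summits.BirchSwinnertonDyer.Rank1Residual.GaloisImage.KolyvaginSystemsCoreRankOne
import Summits.BirchSwinnertonDyer.Rank1Residual.GaloisImage.KolyvaginCoreGraphConnected
import HarnessLib

/-!
# Kolyvagin systems of core rank one over `𝔽_p` are free of rank one — UNCONDITIONAL form: the
# stalk half (existence, row T-R1-56-S) joined with the graph half (injectivity, row T-R1-56-G)
# (cell `b2b-bsdres`, team n1011, ROUTE-1 item R1-56 "S24(1) @ m = 1 in the kernel", FILE E′)

HONEST FRAMING (verbatim for the cell): research route; prove what is provable now; no claim beyond
stated classes; nothing booked; no mark / label moved.  TOOL theorems about Kolyvagin systems of a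
finite Galois module at the residual level `m = 1`; theorems only: no definition, no named fact, no
conjecture node, NO hypothesis of theorem shape left (the `hinj` of `KolyvaginSystemsCoreRankOne.lean`
is discharged here by p11's `CoreRankOne.apply_eq_zero_of_apply_core_eq_zero`).

## What — [S24] Thm. 4.4 (1) / Rubin PCMI Cor. 2.8.9 (2) / MR04 Thm. 4.3.x at `m = 1`, single module

Setting and binders = p11's END theorem verbatim (`K` a number field, `p` prime, `M = T̄` finite
killed by `p`; a Poitou–Tate family `inv` with `IsPerfect`, `SumLocalTermEqZero`,
`SelmerComplement`, `UnramifiedOrthogonal`; `𝓕` unramified outside `S ⊇ {∞, p, Ram(M)}` with finite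
Selmer and dual Selmer groups; the residual self-duality `θ : M ⥲ M^D` with inverse `θ′`; `𝓕`
residually coisotropic; CORE RANK ONE; a Kolyvagin datum `D` with `𝒫 ∩ S = ∅`, local shapes
`#H¹_ur = #H¹_tr = p`, `H¹_ur ⊔ H¹_tr = ⊤`, `θ`-self-dual transverse conditions, admissible comparison
maps; the prime choices over `H¹(K, T̄)`: three classes (`hch3`, Sakamoto Cor. 5.5) and four
classes in dimension `≥ 3` (`hL52`, Sakamoto Lemma 5.2)).  CONCLUSION
(`isFreeRankOneZMod_and_bijective_of_coreRankOne`): `KS₁(M, 𝓕, 𝒫)` is free of rank one over `ℤ/p`,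
and `κ ↦ κ_d` is a bijection `KS₁ → H¹_{𝓕(d)}(K, M)` at every level `d` with `H¹_{𝓕(d)^*}(K, M^D) = 0`
— the conclusion of `Sakamoto2024.kolyvaginSystems_freeRankOne_zmod_three_pow_at 1` for one module.
At `p = 3` the two prime choices are p15's T-C55K / T-C55K-4 theorems (PROVED from Chebotarev in the
tree); the consumer `SakamotoRankOneAtOne.lean` (FILE F) discharges them and the local shapes.

References: R. Sakamoto, JTNB 36 (2024) Thm. 4.4 (1), §§5–6, Prop. 7.6; K. Rubin, PCMI 18 (2011)
Cor. 2.8.9; B. Mazur, K. Rubin, Mem. AMS 799 (2004) §4.3 (not held; reconstructed at `m = 1` in the two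
rows) and JTNB 28 (2016) §§6, 8.
-/

noncomputable section

open scoped Classical NumberField ContRepresentation
open Function NumberField IsDedekindDomain
open Literature.NumberTheory.GaloisRepresentations Literature.NumberTheory.GaloisRepresentations.DiscreteGaloisModule
  Literature.NumberTheory.GaloisCohomology
open Summit.BirchSwinnertonDyer.Rank1Residual.GaloisImage.CoreRankZero

universe u

namespace Summit.BirchSwinnertonDyer.Rank1Residual.GaloisImage.CoreRankOne

variable {K : Type u} [Field K] [NumberField K]
variable {M : Type u} [AddCommGroup M] [TopologicalSpace M] [DiscreteTopology M] [Finite M]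
variable {ρ : DiscreteGaloisModule K M} {p : ℕ} [Fact p.Prime] {inv : LocalInvariants K p}
variable {S : Finset (Place K)} {𝓕 : SelmerStructure ρ} {D : KolyvaginDatum ρ}

/-- **Kolyvagin systems of core rank one over `𝔽_p`: `KS₁(M, 𝓕, 𝒫)` is free of rank one over `ℤ/p`
and `κ ↦ κ_d` is bijective onto `H¹_{𝓕(d)}(K, M)` at every core vertex `d`** — [S24] Thm. 4.4 (1) at
`m = 1` on a single module, UNCONDITIONALLY in the kernel (existence: the volume-form Kolyvagin system
of row T-R1-56-S; injectivity: the connectedness of the core graph, p11's row T-R1-56-G).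
[cite: Sakamoto2024, Thm. 4.4 (1) (p. 926) and Prop. 7.6 (p. 936)]
[cite: Rubin2011, Cor. 2.8.9 (2) (p. 25)] -/
theorem isFreeRankOneZMod_and_bijective_of_coreRankOne (hperf : inv.IsPerfect)
    (hsum : inv.SumLocalTermEqZero) (hcompl : inv.SelmerComplement) (hur : inv.UnramifiedOrthogonal)
    (hM : ∀ m : M, p • m = 0)
    (hS : ∀ v : HeightOneSpectrum (𝓞 K), (Sum.inr v : Place K) ∉ S →
      ((p : ℕ) : 𝓞 K) ∉ v.asIdeal ∧ GaloisRep.IsUnramifiedAt v ρ)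
    (h𝓕 : 𝓕.IsUnramifiedOutside S) (hfin : Finite 𝓕.selmerGroup)
    (hfind : Finite (inv.dualSelmerStructure ρ 𝓕).selmerGroup)
    (θ : ρ.toContRepresentation →ⁱL (ρ.tateDual p).toContRepresentation)
    (θ' : (ρ.tateDual p).toContRepresentation →ⁱL ρ.toContRepresentation)
    (hθθ' : ∀ a : M, θ' (θ a) = a) (hθ'θ : ∀ b, θ (θ' b) = b)
    (hcois : inv.IsResiduallyCoisotropic 𝓕 θ S) (hχ : LocalInvariants.HasCoreRank inv 𝓕 p 1)
    (hPS : ∀ q ∈ D.primes, (Sum.inr q : Place K) ∉ S)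
    (hU : ∀ q ∈ D.primes, Nat.card (unramifiedSubgroup (GaloisRep.toLocal q ρ) 1) = p)
    (hT : ∀ q ∈ D.primes, Nat.card (D.transverse (Sum.inr q)) = p)
    (hUT : ∀ q ∈ D.primes,
      unramifiedSubgroup (GaloisRep.toLocal q ρ) 1 ⊔ D.transverse (Sum.inr q) = ⊤)
    (hTθ : ∀ q ∈ D.primes, (inv.dualLocalCondition ρ (Sum.inr q) (D.transverse (Sum.inr q))).comap
      (localMap θ (Sum.inr q)) = D.transverse (Sum.inr q))
    (hch3 : ∀ c₁ c₂ c₃ : galoisCohomology ρ 1, c₁ ≠ 0 → c₂ ≠ 0 → c₃ ≠ 0 →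
      {q ∈ D.primes | galoisCohomology.localization ρ (Sum.inr q) 1 c₁ ≠ 0 ∧
        galoisCohomology.localization ρ (Sum.inr q) 1 c₂ ≠ 0 ∧
        galoisCohomology.localization ρ (Sum.inr q) 1 c₃ ≠ 0}.Infinite)
    (hL52 : ∀ c₁ c₂ c₃ c₄ : galoisCohomology ρ 1,
      (∀ a : Fin 3 → ZMod p, (∑ i, (a i).val • ![c₁, c₂, c₃] i) = 0 → a = 0) → c₄ ≠ 0 →
      {q ∈ D.primes | galoisCohomology.localization ρ (Sum.inr q) 1 c₁ ≠ 0 ∧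
        galoisCohomology.localization ρ (Sum.inr q) 1 c₂ ≠ 0 ∧
        galoisCohomology.localization ρ (Sum.inr q) 1 c₃ ≠ 0 ∧
        galoisCohomology.localization ρ (Sum.inr q) 1 c₄ ≠ 0}.Infinite)
    (hadm : D.IsAdmissible) :
    KolyvaginSystem.IsFreeRankOneZMod (D.kolyvaginSystems 𝓕) p ∧
      ∀ (d : Finset (HeightOneSpectrum (𝓞 K))) (hd : D.IsLevel d),
        (inv.dualSelmerStructure ρ (D.atLevel 𝓕 d)).selmerGroup = ⊥ →
        Function.Bijective fun κ : D.kolyvaginSystems 𝓕 =>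
          (⟨κ.1 d, ((KolyvaginDatum.mem_kolyvaginSystems_iff D 𝓕 κ.1).mp κ.2).mem_selmerGroup d hd⟩ :
            (D.atLevel 𝓕 d).selmerGroup) := by
  have hch : ∀ c₁ c₂ : galoisCohomology ρ 1, c₁ ≠ 0 → c₂ ≠ 0 →
      {q ∈ D.primes | galoisCohomology.localization ρ (Sum.inr q) 1 c₁ ≠ 0 ∧
        galoisCohomology.localization ρ (Sum.inr q) 1 c₂ ≠ 0}.Infinite := fun c₁ c₂ h₁ h₂ =>
    (hch3 c₁ c₂ c₁ h₁ h₂ h₁).mono fun q hq => ⟨hq.1, hq.2.1, hq.2.2.1⟩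
  exact isFreeRankOneZMod_and_bijective hperf hsum hcompl hM hS h𝓕 hfin hfind hχ hPS hadm hU hT hUT hθ'θ hch
    fun κ hκ n₀ hn₀ hcore₀ hκ₀ n =>
      apply_eq_zero_of_apply_core_eq_zero hperf hsum hcompl hur hM hS h𝓕 hfin hfind θ θ' hθθ' hθ'θ hcois hχ
        hPS hU hT hUT hTθ hch3 hL52 hadm hκ hn₀ hcore₀ hκ₀ n

end Summit.BirchSwinnertonDyer.Rank1Residual.GaloisImage.CoreRankOne

end
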